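/- WIDTH seat `ym-line-cbag-p1-w3` (prover-ym-line-cbag-p1-w3-g16-0), LINE 7 `GlueballBandRecursion`, in support of ⟨stmt-QuantumFields-22957⟩
`OneParticleBlochSymbolFamily` (= `Band.EffectiveBlochSymbolFamily`): companion of `…BandUpperGap.lean` (p659444) answering the LEAD's
composition request (STATUS 2026-08-28T18:55:16Z): the remainder of the thermal trace above an isolated band PROPAGATES geometrically from
ANY anchor time, so a factor-`C` trace bound at ONE time `s(β, N)` gives it at all later times — the shape the one-stub skeleton consumes.
Route-independent (no `Theses` import); definition-free; a helper. -/
import Summits.QuantumFields.YangMills.Theorems.GlueballBandRecursionBandUpperGap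

/-!
# Route `GlueballBandRecursion`, item `OneParticleBlochSymbolFamily` (stmt-QuantumFields-22957): the upper half of (P4) propagates
# in the Euclidean time from one anchor (stub S4, spectral part — general anchor)

Notation: `x_t = traceExcess r.ρ β N t`, `S_t = Σ_k (μ_k/λ₊)^t` for a finite orthonormal excited eigenfamily `e_k` (`μ_k < λ₊`) of the
transfer matrix `𝕋`, `R_t = x_t − S_t ≥ 0` the remainder (everything in the sub-dominant spectrum outside the band), `Θ` an upper gap
for the eigenvectors with eigenvalue `< λ₊` orthogonal to the band (standing data of `…BandUpperGap.lean` §2, rate `q_N < 1`).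

* §1 `sub_sum_pow_le_pow_mul_of_gap` (abstract Hilbert space): `X_t − Σ_k μ_k^t ≤ Θ^{t−s}·(X_s − Σ_k μ_k^s)` for `s ≤ t` — the
  remainder-to-remainder form of `le_sum_pow_add_pow_mul_of_gap`.
* §2 `traceExcess_sub_le_pow_mul_sub_of_upperGap`: `R_{m+2} ≤ (Θ/λ₊)^{m−m'}·R_{m'+2}` for all `m' ≤ m` (GENERAL anchor; the landed
  `traceExcess_le_sum_pow_div_add_of_upperGap` is the anchor `m' = 0` weakened by `R_2 ≤ x_2`);
  `traceExcess_le_mul_sum_pow_div_of_anchor`: if `Θ ≤ μ_k` for all `k` and `x_{m'+2} ≤ C·S_{m'+2}` at ONE anchor `m'` (`C ≥ 1`), then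
  `x_{m+2} ≤ C·S_{m+2}` for ALL `m ≥ m'` (`S` decays no faster than `(min μ/λ₊)^{·}`, `R` at least as fast as `(Θ/λ₊)^{·}`);
  the same in Bloch currency (`…_sum_re_trace_transferBloch_pow_of_anchor`, LEAD's `transfer_bloch_reduction`) and, for `C = 2` and an
  anchor `m' + 2 ≤ N/4`, LITERALLY the (P4) clause shape of `Band.EffectiveBlochSymbolFamily` for the exact Bloch blocks `B̂(cubeToSite p)`:
  `p4Shape_cube_of_anchor : ∃ m₀, ∀ m, (m₀ ≤ m ∨ N/4 = m+2) → ½·Σ_p Re tr B̂^{m+2} ≤ x_{m+2} ∧ x_{m+2} ≤ 2·Σ_p Re tr B̂^{m+2}`.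
  So the dilute-gas stub S4b reduces to a factor-2 bound at a SINGLE anchor time `s(β, N) ≤ ⌊N/4⌋` (a fixed anchor does not do uniformly
  in `N`: `x_2(N) ≈ exp(n N³ q²) − 1`, LEAD's caveat).

Sources: folklore.  HONEST FRAMING.  Spectral bookkeeping for a conditional door; item ⟨stmt-QuantumFields-22957⟩, the rung
`ColdDoublingRecursionStrongCoupling` (RECORD-type, strong coupling) and the Yang–Mills mass gap / the summit `YangMills` are NOT proved
or advanced here.
-/

set_option autoImplicit false

noncomputable section

open scoped InnerProductSpace BigOperators
open MeasureTheory Filter Topology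
open Literature.MathematicalPhysics.QuantumFieldTheory

namespace Summit.QuantumFields.YangMills.Theorems.GlueballBandRecursion.Band

/-! ### §1 Abstract: remainder-to-remainder propagation -/

section Abstract

variable {E : Type*} [NormedAddCommGroup E] [InnerProductSpace ℝ E] {ι : Type*} (b : HilbertBasis ι ℝ E)

/-- **Remainder propagation.**  With the data of `hasSum_update_pow_mul_defect` at two times `s ≤ t` (`Σ_{i ≠ i₀} λᵢ^s = X_s`,
`Σ_{i ≠ i₀} λᵢ^t = X_t`, `λᵢ ≥ 0`) and the basis form of the upper gap (`λᵢ ≤ Θ` or `Σ_k ⟪bᵢ, e_k⟫² = 1` off `i₀`):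
`X_t − Σ_k μ_k^t ≤ Θ^{t−s}·(X_s − Σ_k μ_k^s)` (termwise `λᵢ^t wᵢ ≤ Θ^{t−s} λᵢ^s wᵢ` on the defect series). [folklore] -/
theorem sub_sum_pow_le_pow_mul_of_gap [DecidableEq ι] (T : E →L[ℝ] E) (hT : (T : E →ₗ[ℝ] E).IsSymmetric)
    (lam : ι → ℝ) (hb : ∀ i, T (b i) = lam i • b i) (hlam : ∀ i, 0 ≤ lam i) (i₀ : ι) {s t : ℕ} (hst : s ≤ t)
    {Xs Xt : ℝ} (hXs : HasSum (Function.update (fun i => lam i ^ s) i₀ 0) Xs)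
    (hXt : HasSum (Function.update (fun i => lam i ^ t) i₀ 0) Xt)
    {P : Type*} [Fintype P] (e : P → E) (he : Orthonormal ℝ e) (μ : P → ℝ)
    (hμ : ∀ p, T (e p) = μ p • e p) (hne : ∀ p, μ p ≠ lam i₀) {Θ : ℝ}
    (hgap : ∀ i, i ≠ i₀ → lam i ≤ Θ ∨ ∑ p, ⟪b i, e p⟫_ℝ ^ 2 = 1) :
    Xt - ∑ p, μ p ^ t ≤ Θ ^ (t - s) * (Xs - ∑ p, μ p ^ s) := by
  have hDt := hasSum_update_pow_mul_defect b T hT lam hb i₀ t hXt e he μ hμ hne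
  have hDs := hasSum_update_pow_mul_defect b T hT lam hb i₀ s hXs e he μ hμ hne
  have hw0 : ∀ i, 0 ≤ 1 - ∑ p, ⟪b i, e p⟫_ℝ ^ 2 := fun i =>
    sub_nonneg.2 (sum_inner_sq_le_one he (b.orthonormal.1 i))
  refine hasSum_le (fun i => ?_) hDt (hDs.mul_left _)
  by_cases hi : i = i₀
  · subst hi; simp
  · rw [Function.update_of_ne hi, Function.update_of_ne hi]
    rcases hgap i hi with h | h
    · have h1 : lam i ^ t ≤ Θ ^ (t - s) * lam i ^ s := by
        calc lam i ^ t = lam i ^ (t - s) * lam i ^ s := by rw [← pow_add, Nat.sub_add_cancel hst]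
          _ ≤ Θ ^ (t - s) * lam i ^ s :=
            mul_le_mul_of_nonneg_right (pow_le_pow_left₀ (hlam i) h _) (pow_nonneg (hlam i) _)
      calc lam i ^ t * (1 - ∑ p, ⟪b i, e p⟫_ℝ ^ 2)
          ≤ Θ ^ (t - s) * lam i ^ s * (1 - ∑ p, ⟪b i, e p⟫_ℝ ^ 2) := mul_le_mul_of_nonneg_right h1 (hw0 i)
        _ = Θ ^ (t - s) * (lam i ^ s * (1 - ∑ p, ⟪b i, e p⟫_ℝ ^ 2)) := mul_assoc _ _ _
    · rw [h, sub_self, mul_zero, mul_zero, mul_zero]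

end Abstract

/-! ### §2 The transfer matrix: propagation from an anchor time -/

section Transfer

variable {G : Type} [Group G] [TopologicalSpace G] [IsTopologicalGroup G] [CompactSpace G]
  [MeasurableSpace G] [BorelSpace G]

/- Standing data (as in `…BandUpperGap.lean` §2): `β ≥ 0`, rate `q_N < 1`, a finite orthonormal family `e_k` of eigenvectors of
`𝕋 = wilsonTorusTransferMatrix r.ρ β N` with `μ_k < λ₊ = transferSpectralRadius r.ρ β N`, and an upper gap `Θ ≥ 0` for the eigenvectors with
eigenvalue `< λ₊` orthogonal to all `e_k`. -/
variable (r : LatticeRep G) {β : ℝ} (hβ : 0 ≤ β) (N : ℕ) [NeZero N]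
  (hq : (⨅ k : ℕ, traceExcess r.ρ β N (k + 2) ^ ((1 : ℝ) / ((k : ℝ) + 2))) < 1)
  {K : Type*} [Fintype K] (e : K → Lp ℝ 2 (Measure.pi fun _ : Edge 3 N => haarProbability G)) (he : Orthonormal ℝ e)
  (μ : K → ℝ) (hμ : ∀ k, wilsonTorusTransferMatrix r.ρ β N (e k) = μ k • e k)
  (hlt : ∀ k, μ k < transferSpectralRadius r.ρ β N) {Θ : ℝ} (hΘ : 0 ≤ Θ)
  (hgap : ∀ (v : Lp ℝ 2 (Measure.pi fun _ : Edge 3 N => haarProbability G)) (l : ℝ), v ≠ 0 →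
    wilsonTorusTransferMatrix r.ρ β N v = l • v → l < transferSpectralRadius r.ρ β N →
    (∀ k, ⟪e k, v⟫_ℝ = 0) → l ≤ Θ)
include hβ hq he hμ hlt hΘ hgap

omit hΘ in
/-- **Remainder propagation for the transfer matrix (general anchor).**  For all `m' ≤ m`:
`x_{m+2} − Σ_k (μ_k/λ₊)^{m+2} ≤ (Θ/λ₊)^{m−m'} · (x_{m'+2} − Σ_k (μ_k/λ₊)^{m'+2})` (`x = traceExcess r.ρ β N`): what sits above the band in the
thermal trace decays at least like `(Θ/λ₊)^{·}` from ANY anchor time `m' + 2`.  (`Θ ≥ 0` is not needed here.) -/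
theorem traceExcess_sub_le_pow_mul_sub_of_upperGap {m' m : ℕ} (hm : m' ≤ m) :
    traceExcess r.ρ β N (m + 2) - ∑ k, (μ k / transferSpectralRadius r.ρ β N) ^ (m + 2) ≤
      (Θ / transferSpectralRadius r.ρ β N) ^ (m - m') *
        (traceExcess r.ρ β N (m' + 2) - ∑ k, (μ k / transferSpectralRadius r.ρ β N) ^ (m' + 2)) := by
  classical
  haveI : SecondCountableTopology G :=
    (r.continuous.isClosedEmbedding r.injective).isEmbedding.secondCountableTopology
  obtain ⟨s, _, b, lam, i₀, hb, hle, hL0, hrad, hx, hqi, -⟩ := exists_eigenData_rate r hβ N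
  have hT := (isSelfAdjoint_wilsonTorusTransferMatrix N r.continuous r.mem_unitary β).isSymmetric
  have hx' : ∀ n : ℕ, HasSum (Function.update (fun i => lam i ^ (n + 2)) i₀ 0)
      (traceExcess r.ρ β N (n + 2) * lam i₀ ^ (n + 2)) := by
    intro n
    refine ((hx n).mul_right (lam i₀ ^ (n + 2))).congr_fun fun i => ?_
    by_cases hi : i = i₀
    · subst hi; simp
    · rw [Function.update_of_ne hi, Function.update_of_ne hi, div_pow, div_mul_cancel₀ _ (pow_ne_zero _ hL0.ne')]
  have htop : ∀ i, i ≠ i₀ → lam i < lam i₀ := fun i hi =>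
    (hqi i hi).trans_lt (mul_lt_of_lt_one_left hL0 hq)
  have hne : ∀ k, μ k ≠ lam i₀ := fun k => by rw [← hrad]; exact (hlt k).ne
  have hgap' : ∀ (v : Lp ℝ 2 (Measure.pi fun _ : Edge 3 N => haarProbability G)) (l : ℝ), v ≠ 0 →
      wilsonTorusTransferMatrix r.ρ β N v = l • v → ⟪b i₀, v⟫_ℝ = 0 → (∀ k, ⟪e k, v⟫_ℝ = 0) → l ≤ Θ :=
    fun v l hv hTv h0 hortho =>
      hgap v l hv hTv (hrad ▸ eigenvalue_lt_of_inner_eq_zero b _ hT lam hb i₀ htop hv hTv h0) hortho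
  have hgapb : ∀ i, i ≠ i₀ → lam i ≤ Θ ∨ ∑ k, ⟪b i, e k⟫_ℝ ^ 2 = 1 := fun i hi =>
    eigenvalue_le_or_sum_inner_sq_eq_one b _ hT lam hb i₀ e he μ hμ hne hgap' hi
  have hmain := sub_sum_pow_le_pow_mul_of_gap b _ hT lam hb (fun i => (hle i).1) i₀ (s := m' + 2) (t := m + 2)
    (by omega) (hx' m') (hx' m) e he μ hμ hne hgapb
  rw [show m + 2 - (m' + 2) = m - m' from by omega] at hmain
  -- normalise by `λ_{i₀}^{m+2} = λ_{i₀}^{m−m'}·λ_{i₀}^{m'+2}`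
  rw [hrad]
  have hΛne : lam i₀ ≠ 0 := hL0.ne'
  have hpow : lam i₀ ^ (m + 2) = lam i₀ ^ (m - m') * lam i₀ ^ (m' + 2) := by
    rw [← pow_add]; congr 1; omega
  have hsd : ∀ t : ℕ, ∑ k, (μ k / lam i₀) ^ t = (∑ k, μ k ^ t) / lam i₀ ^ t := fun t => by
    rw [Finset.sum_div]; exact Finset.sum_congr rfl fun k _ => div_pow _ _ _
  have key := div_le_div_of_nonneg_right hmain (pow_nonneg hL0.le (m + 2))
  have e1 : (traceExcess r.ρ β N (m + 2) * lam i₀ ^ (m + 2) - ∑ k, μ k ^ (m + 2)) / lam i₀ ^ (m + 2) =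
      traceExcess r.ρ β N (m + 2) - ∑ k, (μ k / lam i₀) ^ (m + 2) := by
    rw [sub_div, mul_div_cancel_right₀ _ (pow_ne_zero _ hΛne), hsd]
  have e2 : Θ ^ (m - m') * (traceExcess r.ρ β N (m' + 2) * lam i₀ ^ (m' + 2) - ∑ k, μ k ^ (m' + 2)) /
        lam i₀ ^ (m + 2) =
      (Θ / lam i₀) ^ (m - m') * (traceExcess r.ρ β N (m' + 2) - ∑ k, (μ k / lam i₀) ^ (m' + 2)) := by
    rw [hsd, hpow, div_pow]
    field_simp
  rw [e1, e2] at key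
  exact key

/-- **A factor-`C` trace bound propagates from ONE anchor time to all later times.**  If `Θ ≤ μ_k` for every `k` (the gap sits below
the band), `1 ≤ C`, and `x_{m'+2} ≤ C·Σ_k (μ_k/λ₊)^{m'+2}` at an anchor `m'`, then `x_{m+2} ≤ C·Σ_k (μ_k/λ₊)^{m+2}` for every `m ≥ m'`:
the band sum decays no faster than `(min μ/λ₊)^{·} ≥ (Θ/λ₊)^{·}`, the remainder at least that fast.  (With `C = 2`: the upper half of
(P4) at all `m ≥ m'` AND at the crux time from a dilute bound at a single anchor `m' + 2 ≤ N/4` — the residual stub S4b.) -/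
theorem traceExcess_le_mul_sum_pow_div_of_anchor (hΘμ : ∀ k, Θ ≤ μ k) {C : ℝ} (hC : 1 ≤ C) {m' : ℕ}
    (hanchor : traceExcess r.ρ β N (m' + 2) ≤ C * ∑ k, (μ k / transferSpectralRadius r.ρ β N) ^ (m' + 2))
    {m : ℕ} (hm : m' ≤ m) :
    traceExcess r.ρ β N (m + 2) ≤ C * ∑ k, (μ k / transferSpectralRadius r.ρ β N) ^ (m + 2) := by
  classical
  have hΛ : 0 < transferSpectralRadius r.ρ β N := by
    haveI : SecondCountableTopology G :=
      (r.continuous.isClosedEmbedding r.injective).isEmbedding.secondCountableTopology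
    obtain ⟨s, _, b, lam, i₀, -, -, hL0, hrad, -⟩ := exists_eigenData_rate r hβ N
    rw [hrad]; exact hL0
  set Λ : ℝ := transferSpectralRadius r.ρ β N with hΛdef
  have hprop := traceExcess_sub_le_pow_mul_sub_of_upperGap r hβ N hq e he μ hμ hlt hgap hm
  have hθ : 0 ≤ Θ / Λ := div_nonneg hΘ hΛ.le
  -- the band sum decays no faster than `(Θ/Λ)^{m−m'}`
  have hS : (Θ / Λ) ^ (m - m') * ∑ k, (μ k / Λ) ^ (m' + 2) ≤ ∑ k, (μ k / Λ) ^ (m + 2) := by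
    rw [Finset.mul_sum]
    refine Finset.sum_le_sum fun k _ => ?_
    have hμk : 0 ≤ μ k / Λ := div_nonneg (hΘ.trans (hΘμ k)) hΛ.le
    calc (Θ / Λ) ^ (m - m') * (μ k / Λ) ^ (m' + 2) ≤ (μ k / Λ) ^ (m - m') * (μ k / Λ) ^ (m' + 2) :=
          mul_le_mul_of_nonneg_right (pow_le_pow_left₀ hθ (div_le_div_of_nonneg_right (hΘμ k) hΛ.le) _)
            (pow_nonneg hμk _)
      _ = (μ k / Λ) ^ (m + 2) := by rw [← pow_add]; congr 1; omega
  have h1 : traceExcess r.ρ β N (m' + 2) - ∑ k, (μ k / Λ) ^ (m' + 2) ≤ (C - 1) * ∑ k, (μ k / Λ) ^ (m' + 2) := by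
    linarith
  have h2 := mul_le_mul_of_nonneg_left h1 (pow_nonneg hθ (m - m'))
  have h3 : (Θ / Λ) ^ (m - m') * ((C - 1) * ∑ k, (μ k / Λ) ^ (m' + 2)) ≤ (C - 1) * ∑ k, (μ k / Λ) ^ (m + 2) := by
    rw [mul_left_comm]
    exact mul_le_mul_of_nonneg_left hS (by linarith)
  linarith

/- The band as a translation-covariant frame `ψ` (the LEAD's `transfer_bloch_reduction` data). -/
variable {n : ℕ} {ψ : Site 3 N × Fin n → Lp ℝ 2 (Measure.pi fun _ : Edge 3 N => haarProbability G)} (hψ : Orthonormal ℝ ψ)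
  (hcov : ∀ (v x : Site 3 N) (j : Fin n), ψ (v + x, j) = koopmanTranslate N v (ψ (x, j)))
  (hinv : ∀ b, wilsonTorusTransferMatrix r.ρ β N (ψ b) ∈ Submodule.span ℝ (Set.range ψ))
  (he_mem : ∀ k, e k ∈ Submodule.span ℝ (Set.range ψ)) (hψ_mem : ∀ a, ψ a ∈ Submodule.span ℝ (Set.range e))
include hψ hcov hinv he_mem hψ_mem

/-- **Propagation in Bloch currency.**  With the frame data of `transfer_bloch_reduction` (`B̂ = transferBloch r β N ψ`), `Θ ≤ min μ`,
`1 ≤ C`: `x_{m'+2} ≤ C·Σ_{p ∈ (ℤ/N)³} Re tr B̂(p)^{m'+2}` at ONE anchor `m'` ⟹ the same at every `m ≥ m'`. -/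
theorem traceExcess_le_mul_sum_re_trace_transferBloch_pow_of_anchor (hΘμ : ∀ k, Θ ≤ μ k) {C : ℝ} (hC : 1 ≤ C)
    {m' : ℕ} (hanchor : traceExcess r.ρ β N (m' + 2) ≤
      C * ∑ p : Site 3 N, ((transferBloch r β N ψ p ^ (m' + 2)).trace).re)
    {m : ℕ} (hm : m' ≤ m) :
    traceExcess r.ρ β N (m + 2) ≤ C * ∑ p : Site 3 N, ((transferBloch r β N ψ p ^ (m + 2)).trace).re := by
  rw [← transfer_bloch_reduction r β N hψ hcov hinv he hμ he_mem hψ_mem] at hanchor ⊢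
  exact traceExcess_le_mul_sum_pow_div_of_anchor r hβ N hq e he μ hμ hlt hΘ hgap hΘμ hC hanchor hm

/-- **Clause (P4) of the item for the exact Bloch blocks, from ONE anchor.**  With the frame data, `Θ ≤ min μ`, and a factor-2 bound
`x_{m'+2} ≤ 2·Σ_{p ∈ (Fin N)³} Re tr B̂(cubeToSite p)^{m'+2}` at an anchor `m' + 2 ≤ N/4` (the residual dilute-gas input S4b):
`∃ m₀, ∀ m, (m₀ ≤ m ∨ N/4 = m + 2) → ½·Σ_p Re tr B̂(cubeToSite p)^{m+2} ≤ x_{m+2} ∧ x_{m+2} ≤ 2·Σ_p Re tr B̂(cubeToSite p)^{m+2}` —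
LITERALLY the shape of clause (P4) of `Band.EffectiveBlochSymbolFamily` with `B̃(latticeAngle N p) := B̂(cubeToSite p)` (`m₀ := m'`; the
lower half is the landed variational floor with constant `1`). -/
theorem p4Shape_cube_of_anchor (hΘμ : ∀ k, Θ ≤ μ k) {m' : ℕ} (hm'N : m' + 2 ≤ N / 4)
    (hanchor : traceExcess r.ρ β N (m' + 2) ≤
      2 * ∑ p : Fin N × Fin N × Fin N, ((transferBloch r β N ψ (cubeToSite p) ^ (m' + 2)).trace).re) :
    ∃ m₀ : ℕ, ∀ m : ℕ, (m₀ ≤ m ∨ N / 4 = m + 2) →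
      (1 / 2 : ℝ) * ∑ p : Fin N × Fin N × Fin N, ((transferBloch r β N ψ (cubeToSite p) ^ (m + 2)).trace).re ≤
          traceExcess r.ρ β N (m + 2) ∧
        traceExcess r.ρ β N (m + 2) ≤
          2 * ∑ p : Fin N × Fin N × Fin N, ((transferBloch r β N ψ (cubeToSite p) ^ (m + 2)).trace).re := by
  have hsum : ∀ t : ℕ, ∑ p : Fin N × Fin N × Fin N, ((transferBloch r β N ψ (cubeToSite p) ^ t).trace).re =
      ∑ k, (μ k / transferSpectralRadius r.ρ β N) ^ t := fun t => by
    rw [Fintype.sum_equiv cubeEquivSite (fun p => ((transferBloch r β N ψ (cubeToSite p) ^ t).trace).re)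
      (fun v => ((transferBloch r β N ψ v ^ t).trace).re) (fun p => rfl),
      transfer_bloch_reduction r β N hψ hcov hinv he hμ he_mem hψ_mem t]
  rw [hsum] at hanchor
  refine ⟨m', fun m hm => ?_⟩
  have hm' : m' ≤ m := by omega
  have hΛ : ∀ k, 0 ≤ μ k / transferSpectralRadius r.ρ β N := fun k =>
    div_nonneg (hΘ.trans (hΘμ k)) ((hΘ.trans (hΘμ k)).trans (hlt k).le)
  have hS : 0 ≤ ∑ k, (μ k / transferSpectralRadius r.ρ β N) ^ (m + 2) :=
    Finset.sum_nonneg fun k _ => pow_nonneg (hΛ k) _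
  have hlow := sum_pow_div_le_traceExcess r hβ N e he μ hμ hlt m
  have hup := traceExcess_le_mul_sum_pow_div_of_anchor r hβ N hq e he μ hμ hlt hΘ hgap hΘμ (C := 2) (by norm_num)
    hanchor hm'
  rw [hsum]
  exact ⟨by linarith, hup⟩

end Transfer

end Summit.QuantumFields.YangMills.Theorems.GlueballBandRecursion.Band

end
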